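import Summits.QuantumFields.BalabanUV.Beta.FP.ConstrainedWoodbury

/-!
# `BalabanUV.Beta.FP.ReGaugedShotDeterminant` — road «FP» for binder row D1, the FUNCTIONAL (determinant) form of (H′2) at MODEL level
# (owner rulings R-FP-17/R-FP-18, `HOME/b2b-balaban-beta-d1-p3/OWNER-RULINGS-FP-5.md`): Bałaban's one shot in its covariant inner gauge
# = [the UNCONSTRAINED fine functional in the FULL Feynman weight] × [the COARSE covariance determinant] × [the RESIDUAL-MODE determinant], exactly

HONEST DEPENDENCY (page 1, mandatory): continuum YM on T⁴ ⇐ BetaPertH ∧ nine spine estimates (0/9 proved); BetaPertH ⇐ (D1) ∧ (D4) ∧ CAP+tail;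
G-an2-4 gates asym, D1 and NE2/3/4.  HONEST FRAMING (cell contract, verbatim): «discharging `BetaPertH` makes Bałaban's UV stability UNCONDITIONAL —
a real constructive-QFT result; it is NOT the continuum limit and NOT the Clay problem.»  THIS MODULE DISCHARGES NOTHING of the wall: [folklore]
finite-dimensional linear algebra (Mathlib + the tree's `Beta.Composition` (`kkt`, `blockProp`, `det_kkt'`, `logZ`), `Beta.CompositionSingular` (`flucCov`) and
`FP/ConstrainedWoodbury` (`kkt_downdate_eq`, `lift_mul_kktInv_mul_lift_transpose`, leaf-05-g8 p234066) BY NAME); no `def`, no `def … : Prop`, nothing cited,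
0 sorry; 0 wall binders; NOT D1, NOT BetaPertH, NOT continuum, NOT Clay.

ABSOLUTE RULE (cell charter, verbatim): «No internally-minted statement may enter as a cited fact. Every hypothesis is either kernel-proved in this package or a
verbatim quotation of a PUBLISHED theorem with page reference. The manuscript(s) under audit are NOT citable for their own disputed steps — they are the thing
under adjudication; programme-internal (2001/route/tribunal) claims are never citable.»

THE READING (orientation only; nothing of it is asserted).  With `H := Δ₁ + DD^*` (the fine Lagrangian Hessian plus the FULL covariant Feynman weight — a legitimate
complete gauge fixing of the UNCONSTRAINED fine theory, invertible, and at the fixed point translation-invariant: the inverse of `PerfectPropagatorSymbol.PinfSym`),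
`E` the finite-rank deficit with `H − EᵀE = Δ₁ + DΠD^*` (Π = Bałaban's B5 (1.28) projection: the LEGITIMATE covariant inner slice of the CONSTRAINED one shot,
R-FP-18) and `Q := Q_n` the block averaging: `det kkt (H − EᵀE) Q` is the one shot's Gaussian normalisation in the covariant inner gauge, and this file proves
  `det kkt (H − EᵀE) Q = (−1)^{|μ|} · det H · det (Q H⁻¹ Qᵀ) · det (1 − E·flucCov H Q·Eᵀ)`,
i.e. «one shot = unconstrained full-BF fine functional (n-INDEPENDENT) × coarse covariance determinant (where the n-dependence lives; B9 Thm 3.2's type of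
operator) × residual-mode determinant (the toy's matrix `M`, λ_min ≈ 0.93 for Bałaban's Π)» — the functional form of N7-PROOF.v3 (H′2), to be composed with
leaf-06's ghost factorisation and consumed by (H′3)/H3-BOOK.  The kernel-level objects are the composition lane's; this is their model.

WHAT.  §1 `det_downdate : det (K − UᵀU) = det K · det (1 − U K⁻¹ Uᵀ)` (K invertible; `Matrix.det_one_sub_mul_comm`).  §2 **`det_kkt_downdate`**:
`det kkt (H − EᵀE) Q = det kkt H Q · det (1 − E·flucCov H Q·Eᵀ)` — NO invertibility of `H`, only of the bordered matrix.  §3 **`det_kkt_downdate_three`** (H invertible):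
the three-factor form above; `abs_det_kkt_downdate_three`; §4 `logZ_downdate` / **`logZ_downdate_three`**: the `log|·|` forms
`logZ (H − EᵀE) Q = logZ H Q − ½ log|det(1 − EΓ₀Eᵀ)|` and `logZ (H − EᵀE) Q = const − ½ log|det H| − ½ log|det(QH⁻¹Qᵀ)| − ½ log|det(1 − EΓ₀Eᵀ)|`.
Provenance: road FP owner b2b-balaban-beta-d1-p3 gen 5 (prover-b2b-balaban-beta-d1-p3-g5-0), 2026-08-20.  [folklore], 0 def, 0 cite, 0 sorry.
-/

namespace Summit.QuantumFields.BalabanUV.Beta.FP.ReGaugedShotDeterminant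

open scoped Matrix
open Matrix
open Literature.MathematicalPhysics.QuantumFieldTheory.Balaban1983to89.Beta.Composition (kkt blockProp det_kkt' logZ)
open Literature.MathematicalPhysics.QuantumFieldTheory.Balaban1983to89.Beta.CompositionSingular (flucCov)
open Summit.QuantumFields.BalabanUV.Beta.FP.ConstrainedWoodbury (kkt_downdate_eq lift_mul_kktInv_mul_lift_transpose)

variable {𝕜 : Type*} [Field 𝕜]
variable {ι κ ν μ : Type*} [Fintype ι] [Fintype κ] [Fintype ν] [Fintype μ] [DecidableEq ι] [DecidableEq κ] [DecidableEq ν] [DecidableEq μ]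

/-! ## §1 The determinant of a rank-deficit downdate -/

/-- [folklore] **MATRIX DETERMINANT LEMMA, DOWNDATE FORM**: for invertible `K`, `det (K − UᵀU) = det K · det (1 − U K⁻¹ Uᵀ)`. -/
theorem det_downdate (K : Matrix ι ι 𝕜) (U : Matrix κ ι 𝕜) (hK : IsUnit K.det) :
    (K - Uᵀ * U).det = K.det * (1 - U * K⁻¹ * Uᵀ).det := by
  have hfac : K - Uᵀ * U = K * (1 - K⁻¹ * Uᵀ * U) := by
    rw [Matrix.mul_sub, Matrix.mul_one, ← Matrix.mul_assoc, ← Matrix.mul_assoc, Matrix.mul_nonsing_inv K hK, Matrix.one_mul]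
  rw [hfac, Matrix.det_mul, Matrix.det_one_sub_mul_comm (K⁻¹ * Uᵀ) U, ← Matrix.mul_assoc]

/-! ## §2 Through the border: no invertibility of `H` -/

/-- [folklore] **THE BORDERED DETERMINANT OF THE DOWNDATED FORM**: if the bordered matrix `kkt H Q` is invertible, then
`det kkt (H − EᵀE) Q = det kkt H Q · det (1 − E·flucCov H Q·Eᵀ)` — the residual-mode determinant factors off EXACTLY. -/
theorem det_kkt_downdate (H : Matrix ν ν 𝕜) (Q : Matrix μ ν 𝕜) (E : Matrix κ ν 𝕜) (h : IsUnit (kkt H Q).det) :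
    (kkt (H - Eᵀ * E) Q).det = (kkt H Q).det * (1 - E * flucCov H Q * Eᵀ).det := by
  rw [kkt_downdate_eq, det_downdate _ _ h, lift_mul_kktInv_mul_lift_transpose]

/-- [folklore] Hence invertibility of the downdated bordered matrix is EQUIVALENT to that of the residual-mode matrix (given `kkt H Q` invertible). -/
theorem isUnit_det_kkt_downdate_iff (H : Matrix ν ν 𝕜) (Q : Matrix μ ν 𝕜) (E : Matrix κ ν 𝕜) (h : IsUnit (kkt H Q).det) :
    IsUnit (kkt (H - Eᵀ * E) Q).det ↔ IsUnit (1 - E * flucCov H Q * Eᵀ).det := by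
  rw [det_kkt_downdate H Q E h, IsUnit.mul_iff]
  exact ⟨fun hh => hh.2, fun hM => ⟨h, hM⟩⟩

/-! ## §3 With `H` invertible: the three factors -/

/-- [folklore] **THE THREE-FACTOR DECOMPOSITION**: for invertible `H` with `kkt H Q` invertible,
`det kkt (H − EᵀE) Q = (−1)^{|μ|} · det H · det (Q H⁻¹ Qᵀ) · det (1 − E·flucCov H Q·Eᵀ)` —
[unconstrained fine] × [coarse covariance] × [residual modes]. -/
theorem det_kkt_downdate_three (H : Matrix ν ν 𝕜) (Q : Matrix μ ν 𝕜) (E : Matrix κ ν 𝕜) (hH : IsUnit H.det)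
    (h : IsUnit (kkt H Q).det) :
    (kkt (H - Eᵀ * E) Q).det
      = (-1) ^ Fintype.card μ * (H.det * (blockProp H Q).det) * (1 - E * flucCov H Q * Eᵀ).det := by
  rw [det_kkt_downdate H Q E h, det_kkt' H Q hH]

/-- [folklore] Absolute values: `|det kkt (H − EᵀE) Q| = |det H| · |det (QH⁻¹Qᵀ)| · |det (1 − EΓ₀Eᵀ)|`. -/
theorem abs_det_kkt_downdate_three (H : Matrix ν ν ℝ) (Q : Matrix μ ν ℝ) (E : Matrix κ ν ℝ) (hH : IsUnit H.det)
    (h : IsUnit (kkt H Q).det) :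
    |(kkt (H - Eᵀ * E) Q).det| = |H.det| * |(blockProp H Q).det| * |(1 - E * flucCov H Q * Eᵀ).det| := by
  rw [det_kkt_downdate_three H Q E hH h, abs_mul, abs_mul, abs_mul, abs_pow, abs_neg, abs_one, one_pow, one_mul]

/-! ## §4 Logarithmic (`logZ`) forms over `ℝ` -/

/-- [folklore] **THE ONE-LOOP FUNCTIONAL OF THE DOWNDATED SYSTEM**: `logZ (H − EᵀE) Q = logZ H Q − ½·log|det(1 − E·flucCov H Q·Eᵀ)|`
(both bordered determinants nonzero). -/
theorem logZ_downdate (H : Matrix ν ν ℝ) (Q : Matrix μ ν ℝ) (E : Matrix κ ν ℝ) (h : IsUnit (kkt H Q).det)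
    (hM : IsUnit (1 - E * flucCov H Q * Eᵀ).det) :
    logZ (H - Eᵀ * E) Q = logZ H Q - (1 / 2 : ℝ) * Real.log |(1 - E * flucCov H Q * Eᵀ).det| := by
  unfold logZ
  rw [det_kkt_downdate H Q E h, abs_mul, Real.log_mul (abs_ne_zero.mpr h.ne_zero) (abs_ne_zero.mpr hM.ne_zero)]
  ring

/-- [folklore] **THE THREE-TERM FORM**: for invertible `H`,
`logZ (H − EᵀE) Q = ((|ν| − |μ|)/2)·log 2π − ½ log|det H| − ½ log|det(QH⁻¹Qᵀ)| − ½ log|det(1 − EΓ₀Eᵀ)|` —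
the one shot in the covariant inner gauge = unconstrained fine functional + coarse covariance term + residual-mode term. -/
theorem logZ_downdate_three (H : Matrix ν ν ℝ) (Q : Matrix μ ν ℝ) (E : Matrix κ ν ℝ) (hH : IsUnit H.det)
    (h : IsUnit (kkt H Q).det) (hM : IsUnit (1 - E * flucCov H Q * Eᵀ).det) :
    logZ (H - Eᵀ * E) Q
      = ((Fintype.card ν : ℝ) - Fintype.card μ) / 2 * Real.log (2 * Real.pi)
        - (1 / 2 : ℝ) * Real.log |H.det| - (1 / 2 : ℝ) * Real.log |(blockProp H Q).det|
        - (1 / 2 : ℝ) * Real.log |(1 - E * flucCov H Q * Eᵀ).det| := by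
  have hP : IsUnit (blockProp H Q).det := by
    -- from `det kkt H Q = ± det H · det P` and `det kkt H Q ≠ 0`
    have hk := det_kkt' H Q hH
    have hne : (kkt H Q).det ≠ 0 := h.ne_zero
    rw [hk] at hne
    rw [isUnit_iff_ne_zero]
    intro hz
    apply hne
    rw [hz, mul_zero, mul_zero]
  unfold logZ
  rw [abs_det_kkt_downdate_three H Q E hH h,
    Real.log_mul (mul_ne_zero (abs_ne_zero.mpr hH.ne_zero) (abs_ne_zero.mpr hP.ne_zero)) (abs_ne_zero.mpr hM.ne_zero),
    Real.log_mul (abs_ne_zero.mpr hH.ne_zero) (abs_ne_zero.mpr hP.ne_zero)]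
  ring

end Summit.QuantumFields.BalabanUV.Beta.FP.ReGaugedShotDeterminant
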